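import Literature.NumberTheory.EllipticCurves.AnticyclotomicBigGaloisRep
import Summits.BirchSwinnertonDyer.Rank1Residual.X11b.SelmerTorsionControl
import HarnessLib

/-!
# K2 crux 19270 `IMCDivAtErratumDataAll` (H3♭), ROAD FF — the `θ_m`-input of the landed glue
# `XAc.map_charIdeal_le_span_of_roadFF_unr_le` (p477148) from the erratum's (b): TORSION OF THE
# BIG MODULE = BIG MODULE OF THE TORSION, and the transport of `A_g[p^m] ≃ A_f[p^m]`

Cell `bsd-stepL`, seat `bsd-stepL-imc-p1` (g8). `--supports stmt-BirchSwinnertonDyer-19270 --as helper`.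
HONEST FRAMING: BSD is not proved for any pair by this file; it closes no item; no named fact,
no `sorry`. Sequel of `ErratumRoadFiveBigRepInvariants.lean` (same seat). DEFINITIONS WITH
BODIES (three equivalences on the CONSTRUCTED module `BigRepModule 𝒪 p A` of lit g14's
`AnticyclotomicBigGaloisRep.lean`) and theorems.

## What the glue asks, and what this file supplies

The transfer's input `θ m : (M_{g_m}[p^m]).toTopRep ≅ (M_f[p^m]).toTopRep` — an isomorphism of
the `p^m`-torsion SUBREPRESENTATIONS (`TorsionControl.torsionRep`) of the two big representations
`M = bigRep κ ρ` over `Λ_𝒪 = 𝒪⟦T⟧` — is, in print, "(b) a `G_ℚ`-stable lattice `T_{g_m} ⊂ V_{g_m}` and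
an isomorphism `T_{g_m}/p^m T_{g_m} ≃ T/p^m T` as `𝒪[G_ℚ]`-modules" (erratum p. 4; [Ski16, (2-6-1)]),
i.e. — for the discrete inputs `A = V/T` of the co-induced model — a `G`-equivariant `𝒪`-linear
isomorphism of the torsion submodules `e : A_{g_m}[p^m] ≃ A_f[p^m]` ("`𝓜[p^m] ≅ T_f/p^m T_f ⊗_𝒪
Λ_𝒪^*[p^m]`", [Ski16, Lemma 2.3.1]). lit g14's Part 5 (`BigRepModule.mapRangeEquiv`) transports
isomorphisms of the WHOLE coefficient modules `A ≃ A'`; this file adds the torsion bookkeeping: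

* §1 **`torsionValuedEquiv`**: for `c = C r` (`r ∈ 𝒪`), the `c`-torsion of the big module IS the
  big module of the `r`-torsion, `𝒪⟦T⟧`-linearly:
  `BigRepModule 𝒪 p (A[r]) ≃ₗ[𝒪⟦T⟧] (BigRepModule 𝒪 p A)[c]` (`(C r · Φ)(x) = r · Φ(x)`; post-
  composition with `A[r] ↪ A` is `𝒪⟦T⟧`-linear and injective, Part 5, with range the `c`-torsion),
  `G`-equivariantly for `bigRep κ (torsionRep ρ r)` and `torsionRep (bigRep κ ρ) c`
  (`bigRep_torsionValuedEquiv`).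
* §2 **`torsionTransport e`**: an `𝒪`-linear `e : A[r] ≃ A'[r]` induces
  `(BigRepModule 𝒪 p A)[c] ≃ₗ[𝒪⟦T⟧] (BigRepModule 𝒪 p A')[c]`, pointwise `(θ Φ)(x) = e (Φ x)`
  (`coe_torsionTransport_apply`), `G`-equivariant when `e` is (`bigRep_torsionTransport`).
* §3 **`torsionRepIso`**: the resulting isomorphism of topological representations
  `(torsionRep (bigRep κ ρ) c).toTopRep ≅ (torsionRep (bigRep κ ρ') c).toTopRep` (the kernel's
  `TorsionControl.isoOfLinearEquiv`) — with `c = (C p)^m`, `r = p^m` (`map_pow`) this is VERBATIM the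
  glue's `θ m`, from (b) at the `A`-level (`torsionRepIso_pow`, `nonempty_torsionRepIso_pow`).

So the erratum's (b) may be typed by the fact files at the level of the INPUT representations
(`A_{g_m}[p^m] ≃ A_f[p^m]`, `𝒪[G_K]`-linear) — no statement about the big modules is needed.
Pure algebra on the constructed module; CONDITIONAL on nothing; closes nothing.

References: [Castella2018Erratum] §2 p. 4 (b), Lemma 2.1; [Skinner2016PacificMC] §2.3 Lemma 2.3.1
(p. 180: "`𝓜[p^m] ≅ T_f/p^m T_f ⊗_𝒪 Λ_𝒪^*[p^m]`"), §2.6 (2-6-1), §3.1 (b); [Castella2018] §2.1.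
-/

noncomputable section

open PowerSeries Literature.NumberTheory.GaloisRepresentations Literature.NumberTheory.EllipticCurves
  Literature.NumberTheory.EllipticCurves.BigRepModule
  Summit.BirchSwinnertonDyer.Rank1Residual.X11b.TorsionControl

universe u

namespace Summit.BirchSwinnertonDyer.Rank1Residual.X11b.BigRep

variable {𝒪 : Type*} [CommRing 𝒪] {p : ℕ} [Fact p.Prime]
  {A : Type u} [AddCommGroup A] [Module 𝒪 A] {A' : Type u} [AddCommGroup A'] [Module 𝒪 A']

/-! ### §1 `(T ⊗ Λ^*)[C r] = (T ⊗ Λ^*)`-of-`A[r]` -/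

section TorsionValued

/-- Constants act pointwise: `(C r • Φ)(x) = r • Φ(x)`. [cite: Castella2018, §2.2 (ℤ_p[[T]] = Λ acting on 𝒜)] -/
theorem C_smul_apply (r : 𝒪) (Φ : BigRepModule 𝒪 p A) (x : ℤ_[p]) :
    ((C r : PowerSeries 𝒪) • Φ) x = r • Φ x := by
  rw [C_smul, BigRepModule.smul_apply]

/-- **The `C r`-torsion of the big module is the set of `A[r]`-valued functions**:
`C r • Φ = 0 ↔ ∀ x, r • Φ x = 0` ("`𝓜[p^m] ≅ T_f/p^m T_f ⊗ Λ_𝒪^*[p^m]`").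
[cite: Skinner2016PacificMC, §2.3 Lemma 2.3.1 (p. 180)] -/
theorem mem_torsionBy_iff_forall {c : PowerSeries 𝒪} {r : 𝒪} (hc : c = C r)
    (Φ : BigRepModule 𝒪 p A) :
    Φ ∈ Submodule.torsionBy (PowerSeries 𝒪) (BigRepModule 𝒪 p A) c ↔ ∀ x, r • Φ x = 0 := by
  rw [Submodule.mem_torsionBy_iff, hc]
  constructor
  · intro h x
    rw [← C_smul_apply, h, BigRepModule.zero_apply]
  · intro h
    ext x
    rw [C_smul_apply, h, BigRepModule.zero_apply]

/-- Post-composition with `A[r] ↪ A` lands in the `C r`-torsion. [cite: Skinner2016PacificMC, §2.3 Lemma 2.3.1 (p. 180)] -/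
theorem mapRange_subtype_mem_torsionBy {c : PowerSeries 𝒪} {r : 𝒪} (hc : c = C r)
    (Ψ : BigRepModule 𝒪 p (Submodule.torsionBy 𝒪 A r)) :
    mapRangeₗ (p := p) (Submodule.torsionBy 𝒪 A r).subtype Ψ ∈
      Submodule.torsionBy (PowerSeries 𝒪) (BigRepModule 𝒪 p A) c := by
  rw [mem_torsionBy_iff_forall hc]
  intro x
  rw [mapRangeₗ_apply, mapRange_apply, Submodule.subtype_apply]
  exact (Submodule.mem_torsionBy_iff r _).1 (Ψ x).2

/-- Every `C r`-torsion element is an `A[r]`-valued smooth function (surjectivity of post-composition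
onto the torsion). [cite: Skinner2016PacificMC, §2.3 Lemma 2.3.1 (p. 180)] -/
theorem exists_mapRange_subtype_eq {c : PowerSeries 𝒪} {r : 𝒪} (hc : c = C r)
    (Φ : BigRepModule 𝒪 p A) (hΦ : Φ ∈ Submodule.torsionBy (PowerSeries 𝒪) (BigRepModule 𝒪 p A) c) :
    ∃ Ψ : BigRepModule 𝒪 p (Submodule.torsionBy 𝒪 A r),
      mapRangeₗ (p := p) (Submodule.torsionBy 𝒪 A r).subtype Ψ = Φ := by
  rw [mem_torsionBy_iff_forall hc] at hΦ
  obtain ⟨n, hn⟩ := Φ.exists_level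
  obtain ⟨k, hk⟩ := Φ.exists_torsion
  refine ⟨BigRepModule.mk (fun x => ⟨Φ x, (Submodule.mem_torsionBy_iff r _).2 (hΦ x)⟩)
    ⟨⟨n, fun x y hxy => Subtype.ext (hn x y hxy)⟩, ⟨k, fun x => Subtype.ext ?_⟩⟩, ?_⟩
  · simp only [Submodule.coe_smul_of_tower, ZeroMemClass.coe_zero]
    exact hk x
  · ext x
    rfl

/-- **`BigRepModule 𝒪 p (A[r]) ≃ₗ[𝒪⟦T⟧] (BigRepModule 𝒪 p A)[c]`** for `c = C r`: torsion of the
big module = big module of the torsion (post-composition with `A[r] ↪ A`, `𝒪⟦T⟧`-linear and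
injective by Part 5, onto the `c`-torsion by `exists_mapRange_subtype_eq`).
[cite: Skinner2016PacificMC, §2.3 Lemma 2.3.1 (p. 180: "𝓜[p^m] ≅ T_f/p^m T_f ⊗_𝒪 Λ_𝒪^*[p^m]")] -/
def torsionValuedEquiv {c : PowerSeries 𝒪} {r : 𝒪} (hc : c = C r) :
    BigRepModule 𝒪 p (Submodule.torsionBy 𝒪 A r) ≃ₗ[PowerSeries 𝒪]
      Submodule.torsionBy (PowerSeries 𝒪) (BigRepModule 𝒪 p A) c :=
  LinearEquiv.ofBijective
    ((mapRangeₗ (p := p) (Submodule.torsionBy 𝒪 A r).subtype).codRestrict _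
      (mapRange_subtype_mem_torsionBy hc))
    ⟨fun Ψ₁ Ψ₂ h => mapRange_injective (p := p) Subtype.val_injective (congrArg Subtype.val h),
      fun ⟨Φ, hΦ⟩ => by
        obtain ⟨Ψ, hΨ⟩ := exists_mapRange_subtype_eq hc Φ hΦ
        exact ⟨Ψ, Subtype.ext hΨ⟩⟩

/-- Unfolding `torsionValuedEquiv` (as a function `ℤ_p → A`): `(ε Ψ)(x) = Ψ(x)`.
[cite: Skinner2016PacificMC, §2.3 Lemma 2.3.1 (p. 180)] -/
@[simp] theorem coe_torsionValuedEquiv_apply {c : PowerSeries 𝒪} {r : 𝒪} (hc : c = C r)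
    (Ψ : BigRepModule 𝒪 p (Submodule.torsionBy 𝒪 A r)) (x : ℤ_[p]) :
    (torsionValuedEquiv (p := p) hc Ψ : BigRepModule 𝒪 p A) x = (Ψ x : A) := rfl

/-- Unfolding the inverse: `(ε⁻¹ Φ)(x) = Φ(x)` in `A`. [cite: Skinner2016PacificMC, §2.3 Lemma 2.3.1 (p. 180)] -/
@[simp] theorem coe_torsionValuedEquiv_symm_apply {c : PowerSeries 𝒪} {r : 𝒪} (hc : c = C r)
    (Φ : Submodule.torsionBy (PowerSeries 𝒪) (BigRepModule 𝒪 p A) c) (x : ℤ_[p]) :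
    (((torsionValuedEquiv (p := p) (A := A) hc).symm Φ) x : A) = (Φ : BigRepModule 𝒪 p A) x := by
  conv_rhs => rw [← (torsionValuedEquiv (p := p) (A := A) hc).apply_symm_apply Φ]
  rfl

variable [TopologicalSpace 𝒪] [TopologicalSpace A] [DiscreteTopology A]
  {G : Type u} [Group G] [TopologicalSpace G] [ContinuousMul G] [TopologicalSpace (PowerSeries 𝒪)]

/-- `torsionValuedEquiv` is `G`-EQUIVARIANT for `bigRep κ (M[r]-subrep of ρ)` on the left and the
`c`-torsion subrepresentation of `bigRep κ ρ` on the right (both act by `ρ(g)` on values and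
`x ↦ x − κ g` on the variable). [cite: Castella2018Erratum, §2 p. 4 ((b) as 𝒪[G]-modules) and Lemma 2.1 (M_g[ϖ^m] ⊂ M_g)] -/
theorem coe_torsionValuedEquiv_bigRep {c : PowerSeries 𝒪} {r : 𝒪} (hc : c = C r)
    (κ : G →ₜ* Multiplicative ℤ_[p]) (ρ : ContinuousRep G 𝒪 A) (g : G)
    (Ψ : BigRepModule 𝒪 p (Submodule.torsionBy 𝒪 A r)) :
    (torsionValuedEquiv (p := p) hc (bigRep κ (torsionRep ρ r) g Ψ) : BigRepModule 𝒪 p A) =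
      bigRep κ ρ g (torsionValuedEquiv (p := p) hc Ψ : BigRepModule 𝒪 p A) := by
  ext x
  rfl

end TorsionValued

/-! ### §2 Transport of `e : A[r] ≃ A'[r]` to the `C r`-torsion of the big modules -/

section Transport

/-- **`(BigRepModule 𝒪 p A)[c] ≃ₗ[𝒪⟦T⟧] (BigRepModule 𝒪 p A')[c]` from `e : A[r] ≃ₗ[𝒪] A'[r]`**
(`c = C r`): `ε_{A'} ∘ e_* ∘ ε_A⁻¹` with `e_* = BigRepModule.mapRangeEquiv e` (Part 5). For
`r = p^m` and `e` the erratum's (b) read on `A = V/T` this is `M_f[p^m] ≃ M_{g_m}[p^m]` as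
`𝒪⟦T⟧`-modules. [cite: Castella2018Erratum, §2 p. 4 ((b): T_{g_m}/p^m T_{g_m} ≃ T/p^m T)]
[cite: Skinner2016PacificMC, §2.3 Lemma 2.3.1 (p. 180) and §2.6 (2-6-1)] -/
def torsionTransport {c : PowerSeries 𝒪} {r : 𝒪} (hc : c = C r)
    (e : Submodule.torsionBy 𝒪 A r ≃ₗ[𝒪] Submodule.torsionBy 𝒪 A' r) :
    Submodule.torsionBy (PowerSeries 𝒪) (BigRepModule 𝒪 p A) c ≃ₗ[PowerSeries 𝒪]
      Submodule.torsionBy (PowerSeries 𝒪) (BigRepModule 𝒪 p A') c :=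
  ((torsionValuedEquiv (p := p) hc).symm.trans (mapRangeEquiv e)).trans (torsionValuedEquiv hc)

/-- Unfolding `torsionTransport` pointwise: `(θ Φ)(x) = e (Φ x)` in `A'`.
[cite: Skinner2016PacificMC, §2.3 Lemma 2.3.1 (p. 180)] -/
theorem coe_torsionTransport_apply {c : PowerSeries 𝒪} {r : 𝒪} (hc : c = C r)
    (e : Submodule.torsionBy 𝒪 A r ≃ₗ[𝒪] Submodule.torsionBy 𝒪 A' r)
    (Φ : Submodule.torsionBy (PowerSeries 𝒪) (BigRepModule 𝒪 p A) c) (x : ℤ_[p]) :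
    ((torsionTransport (p := p) hc e Φ : BigRepModule 𝒪 p A') x : A') =
      (e ((torsionValuedEquiv (p := p) (A := A) hc).symm Φ x) : A') := rfl

/-- The value fed to `e` is `Φ(x)`: `((ε⁻¹ Φ) x : A) = Φ x` (restated for rewriting under `e`).
[cite: Skinner2016PacificMC, §2.3 Lemma 2.3.1 (p. 180)] -/
theorem coe_torsionValuedEquiv_symm_apply' {c : PowerSeries 𝒪} {r : 𝒪} (hc : c = C r)
    (Φ : Submodule.torsionBy (PowerSeries 𝒪) (BigRepModule 𝒪 p A) c) (x : ℤ_[p]) :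
    ((torsionValuedEquiv (p := p) (A := A) hc).symm Φ x : A) = (Φ : BigRepModule 𝒪 p A) x :=
  coe_torsionValuedEquiv_symm_apply hc Φ x

variable [TopologicalSpace 𝒪] [TopologicalSpace A] [DiscreteTopology A] [TopologicalSpace A']
  [DiscreteTopology A'] {G : Type u} [Group G] [TopologicalSpace G] [ContinuousMul G]
  [TopologicalSpace (PowerSeries 𝒪)]

/-- **`G`-equivariance of the transport**: if `e` intertwines the torsion subrepresentations of `ρ`
and `ρ'` ((b) "as `𝒪[G_ℚ]`-modules"), then `torsionTransport e` intertwines the `c`-torsion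
subrepresentations of `bigRep κ ρ` and `bigRep κ ρ'`.
[cite: Castella2018Erratum, §2 p. 4 ((b) as 𝒪[G]-modules, transported to M_g = T_g ⊗ Λ_𝒪^*)] -/
theorem bigRep_torsionTransport {c : PowerSeries 𝒪} {r : 𝒪} (hc : c = C r)
    (κ : G →ₜ* Multiplicative ℤ_[p]) (ρ : ContinuousRep G 𝒪 A) (ρ' : ContinuousRep G 𝒪 A')
    (e : Submodule.torsionBy 𝒪 A r ≃ₗ[𝒪] Submodule.torsionBy 𝒪 A' r)
    (he : ∀ (g : G) (a : Submodule.torsionBy 𝒪 A r),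
      (e (torsionRep ρ r g a) : A') = ρ' g (e a : A'))
    (g : G) (Φ : Submodule.torsionBy (PowerSeries 𝒪) (BigRepModule 𝒪 p A) c) :
    torsionTransport (p := p) hc e (torsionRep (bigRep κ ρ) c g Φ) =
      torsionRep (bigRep κ ρ') c g (torsionTransport (p := p) hc e Φ) := by
  apply Subtype.ext
  ext x
  rw [coe_torsionTransport_apply, torsionRep_apply_coe, bigRep_apply_apply,
    coe_torsionTransport_apply, ← he]
  congr 1
  apply congrArg e
  apply Subtype.ext
  rw [coe_torsionValuedEquiv_symm_apply', torsionRep_apply_coe, torsionRep_apply_coe,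
    bigRep_apply_apply, coe_torsionValuedEquiv_symm_apply']

end Transport

/-! ### §3 The glue's `θ m` -/

section Iso

variable [TopologicalSpace 𝒪] [TopologicalSpace A] [DiscreteTopology A] [TopologicalSpace A']
  [DiscreteTopology A'] {G : Type u} [Group G] [TopologicalSpace G] [ContinuousMul G]
  [TopologicalSpace (PowerSeries 𝒪)] [ContinuousSMul (PowerSeries 𝒪) (BigRepModule 𝒪 p A)]
  [ContinuousSMul (PowerSeries 𝒪) (BigRepModule 𝒪 p A')]

/-- **The isomorphism of topological representations `(M_A[c]) ≅ (M_{A'}[c])`** (`c = C r`) from a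
`G`-equivariant `e : A[r] ≃ A'[r]` — the kernel's `TorsionControl.isoOfLinearEquiv` on
`torsionTransport e`. [cite: Castella2018Erratum, §2 p. 4 (b) and proof of Thm. 1.1 (the congruent members)] -/
def torsionRepIso {c : PowerSeries 𝒪} {r : 𝒪} (hc : c = C r)
    (κ : G →ₜ* Multiplicative ℤ_[p]) (ρ : ContinuousRep G 𝒪 A) (ρ' : ContinuousRep G 𝒪 A')
    (e : Submodule.torsionBy 𝒪 A r ≃ₗ[𝒪] Submodule.torsionBy 𝒪 A' r)
    (he : ∀ (g : G) (a : Submodule.torsionBy 𝒪 A r),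
      (e (torsionRep ρ r g a) : A') = ρ' g (e a : A')) :
    (torsionRep (bigRep (p := p) κ ρ) c).toTopRep ≅ (torsionRep (bigRep (p := p) κ ρ') c).toTopRep :=
  isoOfLinearEquiv (torsionTransport hc e) (bigRep_torsionTransport hc κ ρ ρ' e he)

/-- **The glue's `θ m` VERBATIM** — `(torsionRep (bigRep κ ρ) ((C p)^m)).toTopRep ≅
(torsionRep (bigRep κ ρ') ((C p)^m)).toTopRep` — from a `G`-equivariant `𝒪`-linear
`e : A[p^m] ≃ A'[p^m]` (erratum (b) at level `m`, read on `A = V/T`). Orient `A = A_{g_m}`,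
`A' = A_f` (or use `.symm`). [cite: Castella2018Erratum, §2 p. 4 (a)(b)] [cite: Skinner2016PacificMC, §2.6 (2-6-1) and §3.1 (b)] -/
def torsionRepIso_pow (m : ℕ) (κ : G →ₜ* Multiplicative ℤ_[p]) (ρ : ContinuousRep G 𝒪 A)
    (ρ' : ContinuousRep G 𝒪 A')
    (e : Submodule.torsionBy 𝒪 A ((p : 𝒪) ^ m) ≃ₗ[𝒪] Submodule.torsionBy 𝒪 A' ((p : 𝒪) ^ m))
    (he : ∀ (g : G) (a : Submodule.torsionBy 𝒪 A ((p : 𝒪) ^ m)),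
      (e (torsionRep ρ ((p : 𝒪) ^ m) g a) : A') = ρ' g (e a : A')) :
    (torsionRep (bigRep (p := p) κ ρ) ((C (p : 𝒪) : PowerSeries 𝒪) ^ m)).toTopRep ≅
      (torsionRep (bigRep (p := p) κ ρ') ((C (p : 𝒪) : PowerSeries 𝒪) ^ m)).toTopRep :=
  torsionRepIso (map_pow C (p : 𝒪) m).symm κ ρ ρ' e he

/-- `Nonempty` form of `torsionRepIso_pow` (for consumers taking `θ` through `Classical.choice`, and
for fact files stating (b) as `Nonempty (A[p^m] ≃ A'[p^m])` with equivariance).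
[cite: Castella2018Erratum, §2 p. 4 (a)(b)] -/
theorem nonempty_torsionRepIso_pow (m : ℕ) (κ : G →ₜ* Multiplicative ℤ_[p])
    (ρ : ContinuousRep G 𝒪 A) (ρ' : ContinuousRep G 𝒪 A')
    (h : ∃ e : Submodule.torsionBy 𝒪 A ((p : 𝒪) ^ m) ≃ₗ[𝒪] Submodule.torsionBy 𝒪 A' ((p : 𝒪) ^ m),
      ∀ (g : G) (a : Submodule.torsionBy 𝒪 A ((p : 𝒪) ^ m)),
        (e (torsionRep ρ ((p : 𝒪) ^ m) g a) : A') = ρ' g (e a : A')) :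
    Nonempty ((torsionRep (bigRep (p := p) κ ρ) ((C (p : 𝒪) : PowerSeries 𝒪) ^ m)).toTopRep ≅
      (torsionRep (bigRep (p := p) κ ρ') ((C (p : 𝒪) : PowerSeries 𝒪) ^ m)).toTopRep) := by
  obtain ⟨e, he⟩ := h
  exact ⟨torsionRepIso_pow m κ ρ ρ' e he⟩

end Iso

end Summit.BirchSwinnertonDyer.Rank1Residual.X11b.BigRep

end
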